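import Literature.IUT.LogThetaLattice.FHodgeTheaterGroupoid
import Literature.IUT.LogThetaLattice.DHodgeTheaterGroupoidProofs
import Literature.IUT.HodgeTheaters.ThetaPMEllHodgeTheatersF

/-!
# [IUTchI] Def 6.11 (iii) / Cor 6.12 (i): every printed isomorphism of `Θ^{±ell}`-Hodge theaters has a representative — PROOF companion

Mochizuki, *Inter-universal Teichmüller Theory I*, kurims manuscript (May 2020), §6, Def 6.11 (i)–(iii) pp. 172–173
("poly-isomorphisms … that lift"; "a pair of morphisms … that induce the same poly-isomorphism between the respective
capsules of `ℱ`-prime-strips"), Cor 6.12 (i) p. 173 ("the natural functorially induced map from the set of isomorphisms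
between two Θ^{±ell}-Hodge theaters to the set of isomorphisms between the respective associated `𝒟-Θ^{±ell}`-Hodge
theaters is bijective"; proof: Cor 5.3 (ii)) ([IUTchI] Def 6.11 (iii) p.173) [claim: Mochizuki2012, status: disputed].
Proof-only companion (abc-iut cell, wave-4 seat abc-iut-w4-d045; no definitions of record — the one `def` below is the
comparison MAP, not a new notion) to abc-iut-L6-t3's `FHodgeTheaterGroupoid.lean` (representatives `HTRep.FRepIso`) and
abc-iut-L5-t5's `ThetaPMEllHodgeTheatersF.lean` (the printed, poly-level `ThetaPMEllHT.IsoF`), the `ℱ`-level analogue of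
`DHodgeTheaterGroupoidProofs.lean`. Throughout, [IUTchI] Cor 5.3 (ii) is the NAMED hypothesis
`FKit.IsomFtoDBijective` (abc-iut-L5-t4), exactly as in both parent files.

* `FRepIso.toIsoF` — the printed isomorphism determined by a representative: its `𝒟`-part is `f.toD.toIso`
  (`DHodgeTheaterGroupoid`), its `ℱ`-level capsule / `≻` poly-isomorphisms are the `ℱ`-LIFTS of the `+`-full orbits
  of the `𝒟`-constituents (they lift by Cor 5.3 (ii));
* `FRepIso.toIsoF_surjective` — EVERY printed isomorphism of `Θ^{±ell}`-Hodge theaters has a representative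
  (`DRepIso.toIso_surjective` for the `𝒟`-part, `FRepIso.ofD` for the lifts, injectivity of Cor 5.3 (ii) to
  identify the `ℱ`-level poly-data);
* `FRepIso.toIsoF_eq_iff` — two representatives give the same printed isomorphism iff their `𝒟`-parts do (the
  `ℱ`-data are lifts) — with `DRepIso.toIso_eq_toIso_iff` this describes the fibres completely, and with L5-t5's
  `ThetaPMEllHT.Cor612iF` it is the representative-level reading of Cor 6.12 (i).

Nothing of the series is asserted; no side is taken on [IUTchIII] Cor. 3.12; typed ≠ proved.
-/

noncomputable section

namespace Literature.IUT.LogThetaLattice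

open CategoryTheory
open Literature.IUT.HodgeTheaters Literature.IUT.HodgeTheaters.PMBaseKit

universe u

namespace HTRep.FRepIso

variable {l : ℕ} {K : PMBaseKit.{u} l} {M : K.MultKit} {FK : K.FKit M} {H₁ H₂ : FK.ThetaPMEllHT}

/-- **IUTchI:Def6.11(iii)** (kurims p.173) Extensionality for abc-iut-L5-t5's printed isomorphisms of `Θ^{±ell}`-Hodge
theaters: determined by the `𝒟`-part and the two `ℱ`-level poly-isomorphisms. [claim: Mochizuki2012, status: disputed] -/
theorem _root_.Literature.IUT.HodgeTheaters.PMBaseKit.FKit.ThetaPMEllHT.IsoF.ext'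
    {I J : FKit.ThetaPMEllHT.IsoF H₁ H₂} (hD : I.toD = J.toD) (hcaps : HEq I.capsPoly J.capsPoly)
    (hcod : I.codPoly = J.codPoly) : I = J := by
  obtain ⟨d, caps, cod, h1, h2⟩ := I
  obtain ⟨d', caps', cod', h1', h2'⟩ := J
  cases hD; cases hcod
  obtain rfl : caps = caps' := eq_of_heq hcaps
  rfl

/-- **IUTchI:Cor5.3(ii)** (kurims p.144) Under Cor 5.3 (ii), the `ℱ`-lifts of a poly-isomorphism `P` of associated
`𝒟`-prime-strips map ONTO `P`. [claim: Mochizuki2012, status: disputed] -/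
theorem image_assocDMap_preimage (hbij : FK.IsomFtoDBijective) {F₁ F₂ : FK.FStrip}
    (P : Set (F₁.assocD.Iso F₂.assocD)) :
    FKit.FStrip.assocDMap '' {φ : F₁.Iso F₂ | FKit.FStrip.assocDMap φ ∈ P} = P := by
  ext ψ
  constructor
  · rintro ⟨φ, hφ, rfl⟩
    exact hφ
  · intro hψ
    exact ⟨liftIso hbij ψ, by simpa only [Set.mem_setOf_eq, assocDMap_liftIso] using hψ, assocDMap_liftIso hbij ψ⟩

/-- **IUTchI:Def6.11(iii)** (kurims p.173) **The printed isomorphism of `Θ^{±ell}`-Hodge theaters determined by a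
representative** (abc-iut-L5-t5's `ThetaPMEllHT.IsoF`): `𝒟`-part `f.toD.toIso` (Def 6.4 (iii), poly-level), and the
`ℱ`-level poly-isomorphisms `†𝔉_t ⥲ ‡𝔉_{ι t}`, `†𝔉_≻ ⥲ ‡𝔉_≻` "that lift" (Def 6.11 (i)) the `+`-full orbits of the
`𝒟`-constituents — under Cor 5.3 (ii) (`FKit.IsomFtoDBijective`) these lifts exhaust the orbits.
[claim: Mochizuki2012, status: disputed] -/
def toIsoF (hbij : FK.IsomFtoDBijective) (f : FRepIso H₁ H₂) : FKit.ThetaPMEllHT.IsoF H₁ H₂ where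
  toD := f.toD.toIso
  capsPoly t := {φ | FKit.FStrip.assocDMap φ ∈ DStrip.plusFullPolyIso (f.toD.caps t)}
  codPoly := {φ | FKit.FStrip.assocDMap φ ∈ DStrip.plusFullPolyIso f.toD.cod}
  capsPoly_lifts _ := image_assocDMap_preimage hbij _
  codPoly_lifts := image_assocDMap_preimage hbij _

/-- **IUTchI:Def6.11(iii)** (kurims p.173) The representative's own `ℱ`-level isomorphisms are members of the printed
poly-isomorphisms it determines. [claim: Mochizuki2012, status: disputed] -/
theorem caps_mem_toIsoF (hbij : FK.IsomFtoDBijective) (f : FRepIso H₁ H₂) (t : H₁.T) :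
    f.caps t ∈ (f.toIsoF hbij).capsPoly t := by
  show FKit.FStrip.assocDMap (f.caps t) ∈ DStrip.plusFullPolyIso (f.toD.caps t)
  rw [f.caps_lifts]
  exact DStrip.self_mem_plusFullPolyIso _

/-- **IUTchI:Def6.11(iii)** (kurims p.173) … and likewise for `†𝔉_≻ ⥲ ‡𝔉_≻`. [claim: Mochizuki2012, status: disputed] -/
theorem cod_mem_toIsoF (hbij : FK.IsomFtoDBijective) (f : FRepIso H₁ H₂) : f.cod ∈ (f.toIsoF hbij).codPoly := by
  show FKit.FStrip.assocDMap f.cod ∈ DStrip.plusFullPolyIso f.toD.cod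
  rw [f.cod_lifts]
  exact DStrip.self_mem_plusFullPolyIso _

/-- **IUTchI:Cor6.12(i)** (kurims p.173) Two representatives determine the SAME printed isomorphism of `Θ^{±ell}`-Hodge
theaters iff their `𝒟`-parts determine the same printed isomorphism of `𝒟-Θ^{±ell}`-Hodge theaters (the `ℱ`-data
are lifts: the representative-level reading of "the natural … map … is bijective", Cor 6.12 (i), GIVEN Cor 5.3 (ii));
the latter is described by `DRepIso.toIso_eq_toIso_iff`. [claim: Mochizuki2012, status: disputed] -/
theorem toIsoF_eq_iff (hbij : FK.IsomFtoDBijective) (f g : FRepIso H₁ H₂) :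
    f.toIsoF hbij = g.toIsoF hbij ↔ f.toD.toIso = g.toD.toIso := by
  constructor
  · intro h
    exact congrArg FKit.ThetaPMEllHT.IsoF.toD h
  · intro h
    have hι : f.toD.ι = g.toD.ι := congrArg (fun I => I.pmIso.indexEquiv) h
    have hcapsD : HEq (fun t => DStrip.plusFullPolyIso (f.toD.caps t)) (fun t => DStrip.plusFullPolyIso (g.toD.caps t)) := by
      have := congrArg (fun I => I.pmIso) h
      change f.toD.toPMIso = g.toD.toPMIso at this
      change HEq f.toD.toPMIso.capsPoly g.toD.toPMIso.capsPoly
      rw [this]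
    have hcodD : DStrip.plusFullPolyIso f.toD.cod = DStrip.plusFullPolyIso g.toD.cod := by
      have := congrArg (fun I => I.pmIso.codPoly) h
      exact this
    refine FKit.ThetaPMEllHT.IsoF.ext' h ?_ ?_
    · -- the `ℱ`-capsule poly-isomorphisms: preimages of HEq-equal orbits
      obtain ⟨dF, capsF, codF, hcF, hdF⟩ := f
      obtain ⟨dG, capsG, codG, hcG, hdG⟩ := g
      obtain ⟨ι, hιc, caps, cod, glob, hPM, hEll⟩ := dF
      obtain ⟨ι', hιc', caps', cod', glob', hPM', hEll'⟩ := dG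
      dsimp only at hι hcapsD ⊢
      subst hι
      have hc := eq_of_heq hcapsD
      change HEq (fun t => {φ : (H₁.capsule t).Iso (H₂.capsule (ι t)) |
          FKit.FStrip.assocDMap φ ∈ DStrip.plusFullPolyIso (caps t)})
        (fun t => {φ : (H₁.capsule t).Iso (H₂.capsule (ι t)) |
          FKit.FStrip.assocDMap φ ∈ DStrip.plusFullPolyIso (caps' t)})
      exact heq_of_eq (funext fun t => by rw [congrFun hc t])
    · show {φ | FKit.FStrip.assocDMap φ ∈ DStrip.plusFullPolyIso f.toD.cod} =
        {φ | FKit.FStrip.assocDMap φ ∈ DStrip.plusFullPolyIso g.toD.cod}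
      rw [hcodD]

/-- **IUTchI:Def6.11(iii)** (kurims p.173) **Every printed isomorphism of `Θ^{±ell}`-Hodge theaters has a
representative**, GIVEN Cor 5.3 (ii): `toIsoF` is surjective onto abc-iut-L5-t5's `ThetaPMEllHT.IsoF H₁ H₂`
(a representative of the `𝒟`-part by `DRepIso.toIso_surjective`, its unique `ℱ`-lifts by `FRepIso.ofD`; the printed
`ℱ`-level poly-data ARE the lifts of their `𝒟`-images by the injectivity half of Cor 5.3 (ii)).
[claim: Mochizuki2012, status: disputed] -/
theorem toIsoF_surjective (hbij : FK.IsomFtoDBijective) :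
    Function.Surjective (toIsoF hbij : FRepIso H₁ H₂ → FKit.ThetaPMEllHT.IsoF H₁ H₂) := by
  intro I
  obtain ⟨dI, capsI, codI, hcapsI, hcodI⟩ := I
  obtain ⟨d, rfl⟩ := DHTRep.DRepIso.toIso_surjective dI
  refine ⟨ofD hbij d, FKit.ThetaPMEllHT.IsoF.ext' rfl ?_ ?_⟩
  · refine heq_of_eq (funext fun t => Set.ext fun φ => ?_)
    show FKit.FStrip.assocDMap φ ∈ DStrip.plusFullPolyIso (d.caps t) ↔ φ ∈ capsI t
    have hct : FKit.FStrip.assocDMap '' capsI t = DStrip.plusFullPolyIso (d.caps t) := hcapsI t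
    constructor
    · intro hφ
      rw [← hct] at hφ
      obtain ⟨φ', hφ', he⟩ := hφ
      rwa [← (hbij _ _).1 he]
    · intro hφ
      rw [← hct]
      exact ⟨φ, hφ, rfl⟩
  · ext φ
    show FKit.FStrip.assocDMap φ ∈ DStrip.plusFullPolyIso d.cod ↔ φ ∈ codI
    have hct : FKit.FStrip.assocDMap '' codI = DStrip.plusFullPolyIso d.cod := hcodI
    constructor
    · intro hφ
      rw [← hct] at hφ
      obtain ⟨φ', hφ', he⟩ := hφ
      rwa [← (hbij _ _).1 he]
    · intro hφ
      rw [← hct]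
      exact ⟨φ, hφ, rfl⟩

/-- **IUTchI:Cor6.12(i)** (kurims p.173) Existence form: the printed isomorphisms `†ℋ𝒯^{Θ±ell} ⥲ ‡ℋ𝒯^{Θ±ell}` are exactly
the `f.toIsoF` of the representatives `f : FRepIso †ℋ𝒯 ‡ℋ𝒯` (given Cor 5.3 (ii)). [claim: Mochizuki2012, status: disputed] -/
theorem exists_toIsoF_eq (hbij : FK.IsomFtoDBijective) (I : FKit.ThetaPMEllHT.IsoF H₁ H₂) :
    ∃ f : FRepIso H₁ H₂, f.toIsoF hbij = I :=
  toIsoF_surjective hbij I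

end HTRep.FRepIso

end Literature.IUT.LogThetaLattice
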